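import Mathlib
import Summits.NavierStokesRegularity.NavierStokesRegularity.Theorems.EulerZoomLiouvillePowerGaugeEulerLiouvilleCondenserCircleMeanCapacity

/-!
# LEMMA F — FILAMENT CAPACITY (plate t46-F, nsreg-p2 g34 ROUND-44 §3½, `r44/Sketch44b.lean` `NsregP2.R44.FilamentCapacity`)

Width piece for crux `EulerZoomLiouville.PowerGaugeEulerLiouville` (stmt-NavierStokesRegularity-19832), by name under
LEAD 19832 (ns-typeII-p2 g13); seat ns-sfl-p1 g6, `--supports stmt-NavierStokesRegularity-19832 --as helper`.
A self-contained planar lemma — no flow, no profile: a CONNECTED planar set on which a `C¹` scalar is large costs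
Dirichlet energy according to its RADIUS, not its area.

* `filamentCapacity` — the Sketch44b text VERBATIM: `φ ∈ C¹(ℂ,ℝ)`, `K` connected, `z₀ ∈ K ⊆ closedBall z₀ d`,
  `K` reaches every radius `< d`, `φ ≥ A > 0` on `K`, `0 < d ≤ r/e`, `⨍_{S_r(z₀)} φ ≤ B < A/2` ⇒
  `min{A²/(2π), 2π(A/2 − B)²/log(e·r/d)} ≤ ∫_{B(z₀,r)} ‖Dφ‖²`;
* `filamentCapacity_zero` — the same at `z₀ = 0`; `setIntegral_ball_comp_add_right` — the translation;
* `radius_le_of_ballEnergy_lt` (appendix) — the radius form: if `ℰ_{B(z₀,r)} < A²/(2π)` then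
  `d ≤ e·r·exp(−2π(A/2−B)²/ℰ)` (specks, not filaments);
* geometry helpers: `exists_norm_eq_and_le_of_circleAverage_le` (a mean `≤ c` is attained `≤ c` somewhere on the
  circle), `exists_mem_dist_eq_of_isConnected` (a connected set meets every intermediate circle),
  `annulusIntegral_le_ballIntegral` (sphere is null).

ROUTE (memo LEMMA F): two cases on the circular means `m(ρ)`, `ρ ∈ (d/e, d)` — every such circle meets `K`
(connectedness + IVT for `dist(·, z₀)`): (i) all `m(ρ) ≤ A/2` ⇒ on each circle a point with `φ ≥ A` and a point with
`φ ≤ A/2`, so the two arcs each vary by `≥ A/2` and `A²/(2πρ) ≤ ρ∮‖Dφ‖²` (`Condenser.circleEnergy_ge_of_two_values`),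
then `∫_{d/e}^d dρ/ρ = 1` gives `A²/(2π)`; (ii) some `m(ρ₀) > A/2` ⇒ the MEAN log-capacity count
`2π(m(ρ₀) − m(r))²/log(r/ρ₀) ≤ ℰ_{ρ₀ ≤ ‖z‖ ≤ r}` (`Condenser.annulusEnergy_ge_circleAverage_amplitude`) with
`log(r/ρ₀) ≤ log(e·r/d)`.  Both annuli lie in the closed ball, whose boundary sphere is null.

READING (ROUND-44 §3½): on a quiet slice every connected component of the fast set has super-exponentially small
radius — SPECKS, not filaments; the «not tube-like» escape is closed kinematically.
HONEST FRAMING: plane calculus; proves nothing about the crux E (19832 OPEN), any door Target, or Navier–Stokes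
regularity; no summit statement is touched. [nsreg-p2 ROUND-44 LEMMA F; folklore (logarithmic capacity, Wirtinger-type
oscillation bound on circles)]
-/

noncomputable section

open Set Filter Topology Metric Function MeasureTheory intervalIntegral Complex
open scoped Real NNReal ENNReal

set_option linter.dupNamespace false

namespace Summit.NavierStokesRegularity.NavierStokesRegularity.Theorems.PowerGaugeEulerLiouville.Condenser

/-! ## §1 Geometry: points on circles, connected sets, ball versus annulus -/

/-- If the circular mean of a continuous `ψ` over `‖z‖ = ρ` (`ρ ≥ 0`) is `≤ c`, some point of that circle has
`ψ ≤ c` (minimum on the compact circle and monotonicity of `Real.circleAverage`). [folklore] -/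
theorem exists_norm_eq_and_le_of_circleAverage_le {ψ : ℂ → ℝ} (hψ : Continuous ψ) {ρ c : ℝ} (hρ : 0 ≤ ρ)
    (h : Real.circleAverage ψ 0 ρ ≤ c) : ∃ z : ℂ, ‖z‖ = ρ ∧ ψ z ≤ c := by
  by_contra hcon
  push Not at hcon
  have hne : (sphere (0 : ℂ) ρ).Nonempty := NormedSpace.sphere_nonempty.2 hρ
  obtain ⟨z₀, hz₀, hmin⟩ := (isCompact_sphere (0 : ℂ) ρ).exists_isMinOn hne hψ.continuousOn
  have hz₀n : ‖z₀‖ = ρ := by simpa using hz₀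
  have hlt : c < ψ z₀ := hcon z₀ hz₀n
  have hci : CircleIntegrable ψ 0 ρ := hψ.continuousOn.circleIntegrable'
  have hle : Real.circleAverage (fun _ => ψ z₀) 0 ρ ≤ Real.circleAverage ψ 0 ρ := by
    refine Real.circleAverage_mono (circleIntegrable_const _ _ _) hci fun x hx => ?_
    rw [abs_of_nonneg hρ] at hx
    exact (isMinOn_iff.1 hmin) x hx
  rw [Real.circleAverage_const] at hle
  linarith

/-- In a connected set containing `z₀` and a point at distance `≥ ρ ≥ 0` from `z₀`, some point is at distance exactly
`ρ` from `z₀` (intermediate value theorem for `dist(·, z₀)` on `K`). [folklore] -/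
theorem exists_mem_dist_eq_of_isConnected {K : Set ℂ} (hK : IsConnected K) {z₀ z₁ : ℂ} (hz₀ : z₀ ∈ K)
    (hz₁ : z₁ ∈ K) {ρ : ℝ} (hρ0 : 0 ≤ ρ) (hρ : ρ ≤ dist z₁ z₀) : ∃ z ∈ K, dist z z₀ = ρ := by
  have hcont : ContinuousOn (fun z => dist z z₀) K := (continuous_id.dist continuous_const).continuousOn
  have hsub := hK.isPreconnected.intermediate_value hz₀ hz₁ hcont
  have hmem : ρ ∈ Icc (dist z₀ z₀) (dist z₁ z₀) := by rw [dist_self]; exact ⟨hρ0, hρ⟩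
  obtain ⟨z, hz, hzρ⟩ := hsub hmem
  exact ⟨z, hz, hzρ⟩

/-- An annulus `{a ≤ ‖z‖ ≤ b}` with `b ≤ r` carries at most the energy of the open ball `‖z‖ < r`
(the sphere `‖z‖ = r` is Lebesgue-null). [folklore] -/
theorem annulusIntegral_le_ballIntegral {F : ℂ → ℝ} (hF : Continuous F) (hF0 : ∀ z, 0 ≤ F z) {a b r : ℝ}
    (hb : b ≤ r) : ∫ z in {z : ℂ | a ≤ ‖z‖ ∧ ‖z‖ ≤ b}, F z ≤ ∫ z in ball (0 : ℂ) r, F z := by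
  refine setIntegral_mono_set ?_ (Eventually.of_forall fun z => hF0 z) ?_
  · exact (hF.continuousOn.integrableOn_compact (isCompact_closedBall (0 : ℂ) r)).mono_set
      ball_subset_closedBall
  · have hnull : volume ({z : ℂ | a ≤ ‖z‖ ∧ ‖z‖ ≤ b} \ ball (0 : ℂ) r) = 0 := by
      refine measure_mono_null ?_ (Measure.addHaar_sphere volume (0 : ℂ) r)
      intro z hz
      simp only [Set.mem_sdiff, mem_setOf_eq, Metric.mem_ball, dist_zero_right, not_lt] at hz
      rw [mem_sphere_zero_iff_norm]
      exact le_antisymm (hz.1.2.trans hb) hz.2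
    exact ae_le_set.2 hnull

/-! ## §2 LEMMA F at the origin -/

/-- **FILAMENT CAPACITY at the origin.**  `ψ ∈ C¹(ℂ,ℝ)`, `K` connected with `0 ∈ K ⊆ closedBall 0 d` reaching every
radius `< d`, `ψ ≥ A > 0` on `K`, `d ≤ r/e`, `⨍_{S_r} ψ ≤ B < A/2`  ⇒
`min{A²/(2π), 2π(A/2 − B)²/log(e·r/d)} ≤ ∫_{‖z‖ < r} ‖Dψ‖²`.
Two cases on the circular means over `ρ ∈ (d/e, d)` (each such circle meets `K`): all `≤ A/2` ⇒ oscillation `≥ A/2`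
on each circle ⇒ `A²/(2π)` (`circleEnergy_ge_of_two_values`, `∫_{d/e}^d dρ/ρ = 1`); else the mean capacity count
from that circle to `S_r` (`annulusEnergy_ge_circleAverage_amplitude`). [nsreg-p2 ROUND-44 LEMMA F; folklore] -/
theorem filamentCapacity_zero {ψ : ℂ → ℝ} (hψ : ContDiff ℝ 1 ψ) {K : Set ℂ} {A B d r : ℝ}
    (hK : IsConnected K) (h0K : (0 : ℂ) ∈ K) (hA : ∀ z ∈ K, A ≤ ψ z) (hApos : 0 < A) (hB : B < A / 2)
    (hd : 0 < d) (hdr : d ≤ r / Real.exp 1) (hKd : K ⊆ closedBall (0 : ℂ) d)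
    (hreach : ∀ δ : ℝ, δ < d → ∃ z ∈ K, δ < dist z 0) (hmean : Real.circleAverage ψ 0 r ≤ B) :
    min (A ^ 2 / (2 * π)) (2 * π * (A / 2 - B) ^ 2 / Real.log (Real.exp 1 * r / d)) ≤
      ∫ z in ball (0 : ℂ) r, ‖fderiv ℝ ψ z‖ ^ 2 := by
  have _hKd := hKd
  have hπ : 0 < π := Real.pi_pos
  have he : 0 < Real.exp 1 := Real.exp_pos 1
  have he1 : 1 < Real.exp 1 := by
    have := Real.add_one_lt_exp (one_ne_zero : (1 : ℝ) ≠ 0)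
    linarith
  have hde : d * Real.exp 1 ≤ r := by rwa [le_div_iff₀ he] at hdr
  have hdr' : d < r := by nlinarith
  have hr : 0 < r := hd.trans hdr'
  have hw : 0 < d / Real.exp 1 := div_pos hd he
  have hwd : d / Real.exp 1 < d := div_lt_self hd he1
  have hFc : Continuous fun z => ‖fderiv ℝ ψ z‖ ^ 2 := (hψ.continuous_fderiv one_ne_zero).norm.pow 2
  have hF0 : ∀ z, 0 ≤ ‖fderiv ℝ ψ z‖ ^ 2 := fun z => by positivity
  by_cases hcase : ∃ ρ₀ ∈ Ioo (d / Real.exp 1) d, A / 2 < Real.circleAverage ψ 0 ρ₀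
  · -- case (ii): the radial count from `S_{ρ₀}` to `S_r`
    obtain ⟨ρ₀, ⟨hρ₀l, hρ₀u⟩, hm⟩ := hcase
    have hρ₀pos : 0 < ρ₀ := hw.trans hρ₀l
    have hρ₀r : ρ₀ < r := hρ₀u.trans hdr'
    have hcap := annulusEnergy_ge_circleAverage_amplitude hψ hρ₀pos hρ₀r
    have hball := annulusIntegral_le_ballIntegral hFc hF0 (a := ρ₀) (le_refl r)
    have hΛ₀ : 0 < Real.log (r / ρ₀) := Real.log_pos ((one_lt_div hρ₀pos).2 hρ₀r)
    have hquot : r / ρ₀ ≤ Real.exp 1 * r / d := by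
      rw [div_le_div_iff₀ hρ₀pos hd]
      have h1 : d ≤ Real.exp 1 * ρ₀ := (div_le_iff₀' he).1 hρ₀l.le
      nlinarith [h1, hr.le]
    have hΛ₁ : Real.log (r / ρ₀) ≤ Real.log (Real.exp 1 * r / d) :=
      Real.log_le_log (div_pos hr hρ₀pos) hquot
    have hΔ0 : 0 ≤ A / 2 - B := by linarith
    have hΔ : A / 2 - B ≤ Real.circleAverage ψ 0 ρ₀ - Real.circleAverage ψ 0 r := by linarith
    calc min (A ^ 2 / (2 * π)) (2 * π * (A / 2 - B) ^ 2 / Real.log (Real.exp 1 * r / d))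
        ≤ 2 * π * (A / 2 - B) ^ 2 / Real.log (Real.exp 1 * r / d) := min_le_right _ _
      _ ≤ 2 * π * (A / 2 - B) ^ 2 / Real.log (r / ρ₀) :=
          div_le_div_of_nonneg_left (by positivity) hΛ₀ hΛ₁
      _ ≤ 2 * π * (Real.circleAverage ψ 0 ρ₀ - Real.circleAverage ψ 0 r) ^ 2 / Real.log (r / ρ₀) := by
          gcongr
      _ ≤ ∫ z in {z : ℂ | ρ₀ ≤ ‖z‖ ∧ ‖z‖ ≤ r}, ‖fderiv ℝ ψ z‖ ^ 2 := hcap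
      _ ≤ ∫ z in ball (0 : ℂ) r, ‖fderiv ℝ ψ z‖ ^ 2 := hball
  · -- case (i): oscillation `≥ A/2` on every circle of radius `ρ ∈ (d/e, d)`
    push Not at hcase
    have hcirc : ∀ ρ ∈ Ioo (d / Real.exp 1) d,
        A ^ 2 / (2 * π * ρ) ≤ 2 * π * (ρ * Real.circleAverage (fun z => ‖fderiv ℝ ψ z‖ ^ 2) 0 ρ) := by
      intro ρ hρ
      have hρpos : 0 < ρ := hw.trans hρ.1
      -- a point of `K` on the circle, where `ψ ≥ A`
      obtain ⟨z₁, hz₁K, hz₁⟩ := hreach ρ hρ.2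
      obtain ⟨z, hzK, hzρ⟩ := exists_mem_dist_eq_of_isConnected hK h0K hz₁K hρpos.le hz₁.le
      rw [dist_zero_right] at hzρ
      obtain ⟨θ₁, hθ₁⟩ := exists_circleMap_zero_eq hzρ
      -- a point of the circle where `ψ ≤ A/2`
      obtain ⟨z', hz'ρ, hz'le⟩ :=
        exists_norm_eq_and_le_of_circleAverage_le hψ.continuous hρpos.le (hcase ρ hρ)
      obtain ⟨θ₂, hθ₂⟩ := exists_circleMap_zero_eq hz'ρ
      have hD : A / 2 ≤ ψ (circleMap 0 ρ θ₁) - ψ (circleMap 0 ρ θ₂) := by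
        rw [hθ₁, hθ₂]; linarith [hA z hzK]
      have hosc := circleEnergy_ge_of_two_values hψ hρpos (by positivity : (0 : ℝ) ≤ A / 2) hD
      have hca : ∫ θ in (0 : ℝ)..2 * π, ‖fderiv ℝ ψ (circleMap 0 ρ θ)‖ ^ 2 =
          2 * π * Real.circleAverage (fun z => ‖fderiv ℝ ψ z‖ ^ 2) 0 ρ := by
        rw [Real.circleAverage_def, smul_eq_mul, ← mul_assoc,
          mul_inv_cancel₀ (by positivity : (2 : ℝ) * π ≠ 0), one_mul]
      rw [hca] at hosc
      have hid : 2 * (A / 2) ^ 2 / (π * ρ) = A ^ 2 / (2 * π * ρ) := by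
        rw [div_eq_div_iff (by positivity) (by positivity)]
        ring
      rw [hid] at hosc
      linarith [hosc]
    -- integrate over `ρ ∈ (d/e, d)`
    have hcont : Continuous fun ρ : ℝ => ρ * Real.circleAverage (fun z => ‖fderiv ℝ ψ z‖ ^ 2) 0 ρ :=
      continuous_id.mul (Real.Continuous.circleAverage (c := 0) hFc)
    have hann := annulusIntegral_eq_integral_mul_circleAverage hFc hw hwd.le
    have hball := annulusIntegral_le_ballIntegral hFc hF0 (a := d / Real.exp 1) hdr'.le
    have hlowi : IntervalIntegrable (fun ρ : ℝ => A ^ 2 / (2 * π * ρ)) volume (d / Real.exp 1) d := by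
      refine (ContinuousOn.div continuousOn_const (continuousOn_const.mul continuousOn_id) ?_).intervalIntegrable
      intro ρ hρ
      rw [uIcc_of_le hwd.le] at hρ
      exact ne_of_gt (by nlinarith [hw, hρ.1, hπ] : 0 < 2 * π * ρ)
    have hlow : ∫ ρ in (d / Real.exp 1)..d, A ^ 2 / (2 * π * ρ) ≤
        ∫ ρ in (d / Real.exp 1)..d, 2 * π * (ρ * Real.circleAverage (fun z => ‖fderiv ℝ ψ z‖ ^ 2) 0 ρ) :=
      intervalIntegral.integral_mono_on_of_le_Ioo hwd.le hlowi
        ((continuous_const.mul hcont).intervalIntegrable _ _) hcirc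
    have hval : ∫ ρ in (d / Real.exp 1)..d, A ^ 2 / (2 * π * ρ) = A ^ 2 / (2 * π) := by
      have hfun : (fun ρ : ℝ => A ^ 2 / (2 * π * ρ)) = fun ρ : ℝ => A ^ 2 / (2 * π) * ρ⁻¹ := by
        funext ρ
        rw [div_mul_eq_div_div, div_eq_mul_inv]
      rw [hfun, intervalIntegral.integral_const_mul, integral_inv_of_pos hw hd,
        show d / (d / Real.exp 1) = Real.exp 1 by field_simp, Real.log_exp, mul_one]
    calc min (A ^ 2 / (2 * π)) (2 * π * (A / 2 - B) ^ 2 / Real.log (Real.exp 1 * r / d))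
        ≤ A ^ 2 / (2 * π) := min_le_left _ _
      _ = ∫ ρ in (d / Real.exp 1)..d, A ^ 2 / (2 * π * ρ) := hval.symm
      _ ≤ ∫ ρ in (d / Real.exp 1)..d,
            2 * π * (ρ * Real.circleAverage (fun z => ‖fderiv ℝ ψ z‖ ^ 2) 0 ρ) := hlow
      _ = 2 * π * ∫ ρ in (d / Real.exp 1)..d,
            ρ * Real.circleAverage (fun z => ‖fderiv ℝ ψ z‖ ^ 2) 0 ρ :=
          intervalIntegral.integral_const_mul _ _
      _ = ∫ z in {z : ℂ | d / Real.exp 1 ≤ ‖z‖ ∧ ‖z‖ ≤ d}, ‖fderiv ℝ ψ z‖ ^ 2 := hann.symm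
      _ ≤ ∫ z in ball (0 : ℂ) r, ‖fderiv ℝ ψ z‖ ^ 2 := hball

/-! ## §3 LEMMA F (translation to an arbitrary centre) -/

/-- Translation invariance of the ball energy: `∫_{B(z₀,r)} G = ∫_{B(0,r)} G(· + z₀)`. [folklore] -/
theorem setIntegral_ball_comp_add_right (G : ℂ → ℝ) (z₀ : ℂ) (r : ℝ) :
    ∫ z in ball (0 : ℂ) r, G (z + z₀) = ∫ z in ball z₀ r, G z := by
  rw [← MeasureTheory.integral_indicator measurableSet_ball, ← MeasureTheory.integral_indicator measurableSet_ball]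
  have hind : (fun z => (ball (0 : ℂ) r).indicator (fun z => G (z + z₀)) z) =
      fun z => (ball z₀ r).indicator G (z + z₀) := by
    funext z
    have hiff : z ∈ ball (0 : ℂ) r ↔ z + z₀ ∈ ball z₀ r := by
      simp [Metric.mem_ball, dist_eq_norm]
    by_cases hz : z ∈ ball (0 : ℂ) r
    · rw [indicator_of_mem hz, indicator_of_mem (hiff.1 hz)]
    · rw [indicator_of_notMem hz, indicator_of_notMem (fun h' => hz (hiff.2 h'))]
  rw [hind]
  exact integral_add_right_eq_self (fun z => (ball z₀ r).indicator G z) z₀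

/-- **LEMMA F — FILAMENT CAPACITY** (nsreg-p2 ROUND-44 §3½; the statement is `NsregP2.R44.FilamentCapacity` of
`r44/Sketch44b.lean` VERBATIM).  A connected planar set on which a `C¹` scalar is large costs Dirichlet energy
according to its RADIUS, not its area: with `φ ≥ A > 0` on connected `K ∋ z₀`, `K ⊆ closedBall z₀ d` reaching every
radius `< d`, `d ≤ r/e`, and circular mean `⨍_{S_r(z₀)} φ ≤ B < A/2`,
`min{A²/(2π), 2π(A/2 − B)²/log(e·r/d)} ≤ ∫_{B(z₀,r)} ‖Dφ‖²`.
Consequence on a quiet slice (memo): every connected component of the fast set has super-exponentially small radius —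
specks, not filaments.  Proof: translate to `z₀ = 0` (`filamentCapacity_zero`). [nsreg-p2 ROUND-44 LEMMA F; folklore] -/
theorem filamentCapacity :
    ∀ (φ : ℂ → ℝ), ContDiff ℝ 1 φ → ∀ (K : Set ℂ) (z₀ : ℂ) (A B d r : ℝ),
      IsConnected K → z₀ ∈ K → (∀ z ∈ K, A ≤ φ z) → 0 < A → B < A / 2 →
      0 < d → d ≤ r / Real.exp 1 → K ⊆ Metric.closedBall z₀ d → (∀ δ : ℝ, δ < d → ∃ z ∈ K, δ < dist z z₀) →
      Real.circleAverage φ z₀ r ≤ B →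
        min (A ^ 2 / (2 * π)) (2 * π * (A / 2 - B) ^ 2 / Real.log (Real.exp 1 * r / d)) ≤
          ∫ z in Metric.ball z₀ r, ‖fderiv ℝ φ z‖ ^ 2 := by
  intro φ hφ K z₀ A B d r hK hz₀ hA hApos hB hd hdr hKd hreach hmean
  -- the translated function and set
  have hψ : ContDiff ℝ 1 (fun z : ℂ => φ (z + z₀)) := hφ.comp (contDiff_id.add contDiff_const)
  have hK' : IsConnected ((fun z : ℂ => z - z₀) '' K) :=
    hK.image _ (continuous_id.sub continuous_const).continuousOn
  have h0K' : (0 : ℂ) ∈ (fun z : ℂ => z - z₀) '' K := ⟨z₀, hz₀, sub_self z₀⟩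
  have hA' : ∀ z ∈ (fun z : ℂ => z - z₀) '' K, A ≤ (fun z : ℂ => φ (z + z₀)) z := by
    rintro _ ⟨z, hz, rfl⟩
    simp only [sub_add_cancel]
    exact hA z hz
  have hKd' : (fun z : ℂ => z - z₀) '' K ⊆ closedBall (0 : ℂ) d := by
    rintro _ ⟨z, hz, rfl⟩
    rw [mem_closedBall, dist_zero_right, ← dist_eq_norm]
    exact hKd hz
  have hreach' : ∀ δ : ℝ, δ < d → ∃ z ∈ (fun z : ℂ => z - z₀) '' K, δ < dist z 0 := by
    intro δ hδ
    obtain ⟨z, hz, hlt⟩ := hreach δ hδ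
    exact ⟨z - z₀, ⟨z, hz, rfl⟩, by rwa [dist_zero_right, ← dist_eq_norm]⟩
  have hmean' : Real.circleAverage (fun z : ℂ => φ (z + z₀)) 0 r ≤ B := by
    rw [Real.circleAverage_map_add_const]; exact hmean
  have hmain := filamentCapacity_zero hψ hK' h0K' hA' hApos hB hd hdr hKd' hreach' hmean'
  -- the energies agree
  have hD : ∀ z : ℂ, fderiv ℝ (fun z : ℂ => φ (z + z₀)) z = fderiv ℝ φ (z + z₀) := fun z =>
    fderiv_comp_add_right z₀
  simp_rw [hD] at hmain
  rwa [setIntegral_ball_comp_add_right (fun z => ‖fderiv ℝ φ z‖ ^ 2) z₀ r] at hmain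

/-! ## §4 Radius form (appendix): specks, not filaments -/

/-- **LEMMA F, radius form** (the reading used on quiet slices, ROUND-44 §3½ CONSEQUENCE).  Under the hypotheses of
`filamentCapacity`, if the ball energy `ℰ = ∫_{B(z₀,r)} ‖Dφ‖²` is `< A²/(2π)` (the oscillation case is impossible), then the
radius of `K` about `z₀` is super-exponentially small in the amplitude:  `d ≤ e · r · exp(−2π(A/2 − B)²/ℰ)`.
(From `min{A²/(2π), 2π(A/2−B)²/log(e·r/d)} ≤ ℰ < A²/(2π)`: `log(e·r/d) ≥ 2π(A/2−B)²/ℰ`.) [nsreg-p2 ROUND-44 LEMMA F; folklore] -/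
theorem radius_le_of_ballEnergy_lt (φ : ℂ → ℝ) (hφ : ContDiff ℝ 1 φ) (K : Set ℂ) (z₀ : ℂ) (A B d r : ℝ)
    (hK : IsConnected K) (hz₀ : z₀ ∈ K) (hA : ∀ z ∈ K, A ≤ φ z) (hApos : 0 < A) (hB : B < A / 2)
    (hd : 0 < d) (hdr : d ≤ r / Real.exp 1) (hKd : K ⊆ Metric.closedBall z₀ d)
    (hreach : ∀ δ : ℝ, δ < d → ∃ z ∈ K, δ < dist z z₀) (hmean : Real.circleAverage φ z₀ r ≤ B)
    (hE : ∫ z in Metric.ball z₀ r, ‖fderiv ℝ φ z‖ ^ 2 < A ^ 2 / (2 * π)) :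
    d ≤ Real.exp 1 * r * Real.exp (-(2 * π * (A / 2 - B) ^ 2 / ∫ z in Metric.ball z₀ r, ‖fderiv ℝ φ z‖ ^ 2)) := by
  have hπ : 0 < π := Real.pi_pos
  have he : 0 < Real.exp 1 := Real.exp_pos 1
  have hF := filamentCapacity φ hφ K z₀ A B d r hK hz₀ hA hApos hB hd hdr hKd hreach hmean
  generalize hEdef : ∫ z in Metric.ball z₀ r, ‖fderiv ℝ φ z‖ ^ 2 = E at hF hE ⊢
  -- the second alternative of the `min` is the active one
  have hmin : 2 * π * (A / 2 - B) ^ 2 / Real.log (Real.exp 1 * r / d) ≤ E := by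
    rcases min_choice (A ^ 2 / (2 * π)) (2 * π * (A / 2 - B) ^ 2 / Real.log (Real.exp 1 * r / d)) with h | h
    · rw [h] at hF; linarith
    · rw [h] at hF; exact hF
  -- `e·r/d > 1`, so the logarithm is positive
  have hde : d * Real.exp 1 ≤ r := by rwa [le_div_iff₀ he] at hdr
  have hr : 0 < r := lt_of_lt_of_le (by positivity) hde
  have hquot : 1 < Real.exp 1 * r / d := by
    rw [lt_div_iff₀ hd, one_mul]
    have he1 : 1 < Real.exp 1 := by
      have := Real.add_one_lt_exp (one_ne_zero : (1 : ℝ) ≠ 0); linarith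
    nlinarith
  have hL : 0 < Real.log (Real.exp 1 * r / d) := Real.log_pos hquot
  have hnum : 0 < 2 * π * (A / 2 - B) ^ 2 := by
    have : 0 < A / 2 - B := by linarith
    positivity
  have hEpos : 0 < E := lt_of_lt_of_le (div_pos hnum hL) hmin
  -- `log(e·r/d) ≥ 2π(A/2−B)²/E`
  have hlog : 2 * π * (A / 2 - B) ^ 2 / E ≤ Real.log (Real.exp 1 * r / d) := by
    rw [div_le_iff₀ hEpos]
    have := (div_le_iff₀ hL).1 hmin
    linarith
  -- exponentiate
  have hexp : Real.exp (2 * π * (A / 2 - B) ^ 2 / E) ≤ Real.exp 1 * r / d := by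
    calc Real.exp (2 * π * (A / 2 - B) ^ 2 / E) ≤ Real.exp (Real.log (Real.exp 1 * r / d)) :=
          Real.exp_le_exp.2 hlog
      _ = Real.exp 1 * r / d := Real.exp_log (by positivity)
  rw [Real.exp_neg]
  rw [le_div_iff₀ hd] at hexp
  have hpos : 0 < Real.exp (2 * π * (A / 2 - B) ^ 2 / E) := Real.exp_pos _
  rw [← div_eq_mul_inv, le_div_iff₀ hpos]
  linarith [hexp]

end Summit.NavierStokesRegularity.NavierStokesRegularity.Theorems.PowerGaugeEulerLiouville.Condenser

end
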